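import Summits.BirchSwinnertonDyer.BirchSwinnertonDyer.Theorems.AlignedTransportAtTwoMainConjectureOfRankZeroBSDAtTwoHalfDescentBaseIndexLayerNumbers
import Summits.BirchSwinnertonDyer.BirchSwinnertonDyer.Theorems.AlignedTransportAtTwoMainConjectureOfRankZeroBSDAtTwoSeedKernelEC
import Literature.NumberTheory.EllipticCurves.Rank1Residual.Typed.X11Visibility
import Literature.NumberTheory.EllipticCurves.LeadingTermPPartProofs
import Literature.NumberTheory.EllipticCurves.ComplexMultiplicationBurungaleFlachPrimaryProofs
import HarnessLib

/-!
# Route `AlignedTransportAtTwo`, crux C2 `MainConjectureOfRankZeroBSDAtTwo` (stmt-BirchSwinnertonDyer-22298):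
# THE BASE TERM CARRIES `p^μ`, XV — THE SEED FED BY THE EXACT ONE-LAYER DOOR: PRINT {Kato 17.4 (1)(2)@2, period unit, modularity, GZK} + `BSD(W,2)` +
# ONE inequality between two consecutive honest layer numbers `#Sel_{2^∞}(W/ℚ_{n+1})·#ker g_{n+1} < 2^{2ⁿ}·#Sel_{2^∞}(W/ℚ_n)·#ker g_n` at a layer `n` with `λ₂ < 2ⁿ`
# ⟹ Mazur's `2`-adic main conjecture for `W`; hence C2 BY NAME from PRINT + that certificate on the seed cell — and the certificate is NECESSARY as well (file XIV)

HONEST FRAMING (cell `bsd-f1-sign2`, WIDTH-5 attached prover seat `bsd-line-att-p5` gen 61 on line `birth` of the lead `bsd-line-att-p2`;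
`--supports` stmt-BirchSwinnertonDyer-22298, closes nothing; BSD is NOT proved by any of this; the crux C2, its verdict «blocked-on
`Rank1Residual.GreenbergMuConjectureIrreducible`» and every registered stub (P / T / Kμ / LimDoor / MuIneqʳ / PFμ⁺) are untouched). THEOREMS ONLY — no `def`,
no instance, no named fact, no `sorry`. CONDITIONAL RESULTS: the PRINT binders `h17` (Kato, Astérisque 295, Thm. 17.4 (1)(2) at `2`), `hper` (period unit at `2`),
`hmod` (modularity), `hGZK` (Gross–Zagier–Kolyvagin) are named facts of the tree displayed as hypotheses (Greenberg's Thm. 4.1 `hGr` is NOT displayed: it is the tree's kernel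
theorem, att-p3 g13 `…SeedKernelEC`); the certificate is a displayed hypothesis; nothing is credited and the item stays open. Compared with gen 60's `…BaseIndexSeed`
(`0 < #Sel_n·#ker g_n < 2^{2ⁿ}` at SOME layer) and gen 55's `…LayerIndexCertificateSeed`, the certificate here is the EXACT one-layer door of file XIV
(`…BaseIndexLayerNumbers.mu_eq_zero_iff_layer_seed`): at ANY layer `n` with `λ₂(W) < 2ⁿ` it is necessary AND sufficient for `μ₂(W) = 0`; the `λ`-input is displayed per datum
(`D.lambda < 2ⁿ`; Kato's half `λ₂ ≤ λ_an` — K4 `…TowerLambdaPinch` — turns it into the analytic `λ_an < 2ⁿ`, a modular-symbol number).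

* §1 ★ `exists_natCard_selmerGroupPInfty_eq_pow`: on the seed cell (`r_an = 0`, GZK) `#Sel_{2^∞}(W/ℚ) = 2^s` for some `s` once it is finite (tree: `E(ℚ)` finite, `#Sel = #Ш[2^∞]`, a `2`-group).
* §2 ★★★ `mazurMainConjecture_two_of_bsdp_of_layerRatio_lt`: `W/ℚ` globally minimal, good ordinary at `2`, no rational `2`-torsion abscissa, `r_an = 0`, `BSD(W,2)`; PRINT {`h17`, `hper`, `hmod`,
  `hGZK`}; CERTIFICATE: for every cyclotomic `(κ, γ)` and dual datum `D` a layer `n` with `λ(X) < 2ⁿ`, all `#Sel_{2^∞}(W/ℚ_m)·#ker g_m > 0`, and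
  **`#Sel_{2^∞}(W/ℚ_{n+1})·#ker g_{n+1} < 2^{2ⁿ}·#Sel_{2^∞}(W/ℚ_n)·#ker g_n`** ⟹ **`MazurMainConjecture W 2`**.
* §3 ★★★ `mainConjectureOfRankZeroBSDAtTwo_of_layerRatio_lt`: **C2 BY NAME** from PRINT {`h17` (every curve), `hper`, `hmod`, `hGZK`} + that certificate for every seed-cell curve.
Nothing numerical is asserted about any curve; C2 untouched. Memo `Cruxes/MainConjectureOfRankZeroBSDAtTwo/EULER-BRIDGE-att-p5-g61.md`.

References: K. Kato, Astérisque 295 (2004), Thm. 17.4 (1)(2) [Kato2004Asterisque]; R. Greenberg, LNM 1716 (1999), Conj. 1.11, Thm. 1.10, Thm. 4.1, Lemma 4.3, Prop. 4.14 [GreenbergLNM1716];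
L. Washington, GTM 83, §13.3 Thm. 13.13 [Washington1997]; R. Miller, LMS J. Comput. Math. 14 (2011) Def. 1.1 [Miller2011LMS].
-/

set_option linter.dupNamespace false
set_option autoImplicit false

noncomputable section

open scoped Classical MatrixGroups ModularForm Polynomial

universe u

namespace Summit.BirchSwinnertonDyer.BirchSwinnertonDyer.Theorems.AlignedTransportAtTwoHalfDescentBaseIndexSeedExact

open CongruenceSubgroup WeierstrassCurve Literature.NumberTheory.EllipticCurves Literature.NumberTheory.EllipticCurves.IwasawaAlgebra
  Literature.NumberTheory.EllipticCurves.ModularForms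
  Literature.NumberTheory.EllipticCurves.Rank1Residual
  Literature.NumberTheory.EllipticCurves.Rank1Residual.Typed
  Literature.NumberTheory.EllipticCurves.Greenberg1999
  Summit.BirchSwinnertonDyer.Rank1Residual
  Summit.BirchSwinnertonDyer.Rank1Residual.X1.MuLambda
  Summit.BirchSwinnertonDyer.Rank1Residual.X5
  Summit.BirchSwinnertonDyer.Rank1Residual.F1Sign2
  Summit.BirchSwinnertonDyer.BirchSwinnertonDyer.Theorems.Rank1ResidualX1Defs
  Summit.BirchSwinnertonDyer.BirchSwinnertonDyer.Theses.AlignedTransportAtTwo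
  Summit.BirchSwinnertonDyer.BirchSwinnertonDyer.Theorems
  Summit.BirchSwinnertonDyer.BirchSwinnertonDyer.Theorems.AlignedTransportAtTwoHalfDescentBaseIndexLayerNumbers

/-! ## §1 `#Sel_{2^∞}(W/ℚ)` is a power of `2` on the rank-`0` locus -/

section Selmer

variable (W : WeierstrassCurve ℚ) [W.IsElliptic] [W.IsGloballyMinimal]

omit [W.IsGloballyMinimal] in
/-- ★ **`#Sel_{p^∞}(W/ℚ) = p^s` for some `s`** when `r_an(W) = 0` (GZK: `W(ℚ)` finite, PRINT `hGZK`) and `Sel_{p^∞}(W/ℚ)` is finite: `#Sel_{p^∞}(W/ℚ) = #Ш(W/ℚ)[p^∞]` (tree) and a finite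
`p`-primary group has `p`-power order (tree). [cite: GreenbergLNM1716, §4 p. 102] -/
theorem exists_natCard_selmerGroupPInfty_eq_pow (hGZK : rank_eq_analyticRank_of_analyticRank_le_one) (hr : W.analyticRank = 0) (p : ℕ) [Fact p.Prime]
    [hSel : Finite (W.selmerGroupPInfty p)] : ∃ s : ℕ, Nat.card (W.selmerGroupPInfty p) = p ^ s := by
  haveI : Finite W.toAffine.Point := finite_point_of_analyticRank_eq_zero W hGZK hr
  have hsha := W.natCard_selmerGroupPInfty_eq_natCard_primaryComponent_sha p
  haveI : Finite (AddCommGroup.primaryComponent W.sha p) := Nat.finite_of_card_ne_zero (by rw [← hsha]; exact Nat.card_pos.ne')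
  obtain ⟨k, hk⟩ := exists_natCard_primaryComponent_eq_pow (A := W.sha) (p := p)
  exact ⟨k, hsha.trans hk⟩

end Selmer

/-! ## §2 The seed: `MazurMainConjecture W 2` from PRINT + `BSD(W,2)` + the exact one-layer certificate -/

section Seed

variable (W : WeierstrassCurve ℚ) [W.IsElliptic] [W.IsGloballyMinimal]

/-- ★★★ **MAZUR'S `2`-ADIC MAIN CONJECTURE FROM `BSD(W,2)` AND ONE INEQUALITY BETWEEN TWO CONSECUTIVE HONEST LAYER NUMBERS.** `W/ℚ` elliptic, globally minimal, good ordinary at `2`,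
no rational `2`-torsion abscissa, `r_an = 0`, `BSD(W,2)`; PRINT: Kato 17.4 (1)(2) at `2` (`h17`), the period unit (`hper`), modularity (`hmod`), GZK (`hGZK`). CERTIFICATE (displayed, per curve): for every
cyclotomic `(κ, γ)` and every dual datum `D` there is a layer `n` with `λ(X) < 2ⁿ` (`λ(X) ≤ λ_an` by Kato; displayed here), every `#Sel_{2^∞}(W/ℚ_m)·#ker g_m` positive (the rank-`0` tower), and
**`#Sel_{2^∞}(W/ℚ_{n+1})·#ker g_{n+1} < 2^{2ⁿ}·#Sel_{2^∞}(W/ℚ_n)·#ker g_n`**. Then **`MazurMainConjecture W 2`** (file XIV's exact door gives `μ₂ = 0`; att-p3 g13's `hGr`-free seed engine).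
[cite: Kato2004Asterisque, Thm. 17.4 (1)(2) (p. 273)] [cite: GreenbergLNM1716, Thm. 4.1 (p. 102), Conj. 1.11, Thm. 1.10, §4 Lemma 4.3, Prop. 4.14] [cite: Miller2011LMS, Def. 1.1] -/
theorem mazurMainConjecture_two_of_bsdp_of_layerRatio_lt
    (h17 : ∀ [NeZero (W.conductorNorm ℤ)] (f : CuspForm (Gamma0 (W.conductorNorm ℤ)) 2), kato_divisibility_allPrimes W 2 (f := f))
    (hper : realPeriodRat_eq_unit_mul_plusPeriod_two) (hmod : nonempty_modularParametrizationData)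
    (hGZK : rank_eq_analyticRank_of_analyticRank_le_one) (hord : IsOrdinaryAt W 2)
    (ht : ∀ x : ℚ, ¬ HasRationalTwoTorsionX W x) (hr : W.analyticRank = 0) (hbsd : BSDp W 2)
    (hcert : ∀ (κ : ZpExtension ℚ 2) (γ : Field.absoluteGaloisGroup ℚ), κ.IsCyclotomic → κ.IsTopGenerator γ → IsCyclotomicVariable 2 γ → ∀ D : W.SelmerDualData κ γ,
      ∃ n : ℕ, D.lambda < 2 ^ n ∧ (∀ m, 0 < Nat.card ↥(W.selmerLayer κ m) * Nat.card (W.KerG κ m)) ∧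
        Nat.card ↥(W.selmerLayer κ (n + 1)) * Nat.card (W.KerG κ (n + 1)) < 2 ^ (2 ^ n) * (Nat.card ↥(W.selmerLayer κ n) * Nat.card (W.KerG κ n))) :
    MazurMainConjecture W 2 := by
  refine AlignedTransportAtTwoSeedKernelEC.mazurMainConjecture_two_of_bsdp_of_mu_eq_zero W h17 hper hmod hGZK hord ht hr hbsd ?_
  intro κ γ hκ hγ hγ' D _hD
  obtain ⟨n, hlam, hpos, hlt⟩ := hcert κ γ hκ hγ hγ' D
  -- `Sel_{2^∞}(W/ℚ)` is finite (layer `0` of the certificate) and of `2`-power order (GZK)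
  have h0 := hpos 0
  have hSel0 : Nat.card ↥(W.selmerGroupPInfty 2) ≠ 0 := by
    rw [← W.natCard_selmerLayer_zero_eq κ]
    exact (Nat.pos_of_mul_pos_right h0).ne'
  haveI : Finite ↥(W.selmerGroupPInfty 2) := Nat.finite_of_card_ne_zero hSel0
  obtain ⟨s, hs⟩ := exists_natCard_selmerGroupPInfty_eq_pow W hGZK hr 2
  have hgo : GoodOrd W 2 := hord
  exact (mu_eq_zero_iff_layer_seed W κ hgo ht hκ hγ D hs hpos hlam).mpr hlt

end Seed

/-! ## §3 C2 by name from PRINT + the exact certificate on the seed cell -/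

section Crux

/-- ★★★ **C2 FROM PRINT + ONE LAYER-RATIO INEQUALITY PER SEED CURVE.** PRINT (`h17` for every curve, `hper`, `hmod`, `hGZK`) and, for every seed-cell curve `W` (elliptic, globally minimal, non-CM,
good ordinary at `2`, no rational `2`-torsion, `Δ ∉ ℚ²`, `r_an = 0`), every cyclotomic `(κ, γ)` and every dual datum: a layer `n` with `λ(X) < 2ⁿ`, the rank-`0` tower, and
**`#Sel_{2^∞}(W/ℚ_{n+1})·#ker g_{n+1} < 2^{2ⁿ}·#Sel_{2^∞}(W/ℚ_n)·#ker g_n`** ⟹ the crux statement **`MainConjectureOfRankZeroBSDAtTwo`** by name. CONDITIONAL result (the certificate is a displayed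
hypothesis; nothing is credited; the item stays open); the analytic `μ₂ = 0` hypothesis and `BSD(W,2)` of C2 are consumed by the seed. By file XIV the certificate is EQUIVALENT to `μ₂(W) = 0`
(given `λ(X) < 2ⁿ`), so no generality is lost against stub T. [cite: Kato2004Asterisque, Thm. 17.4 (1)(2) (p. 273)] [cite: GreenbergLNM1716, Thm. 4.1 (p. 102), §1 Conj. 1.11 (p. 58)] -/
theorem mainConjectureOfRankZeroBSDAtTwo_of_layerRatio_lt
    (h17 : ∀ (V : WeierstrassCurve ℚ) [V.IsElliptic] [V.IsGloballyMinimal] [NeZero (V.conductorNorm ℤ)]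
      (f : CuspForm (Gamma0 (V.conductorNorm ℤ)) 2), kato_divisibility_allPrimes V 2 (f := f))
    (hper : realPeriodRat_eq_unit_mul_plusPeriod_two) (hmod : nonempty_modularParametrizationData)
    (hGZK : rank_eq_analyticRank_of_analyticRank_le_one)
    (hcert : ∀ (W : WeierstrassCurve ℚ) [W.IsElliptic] [W.IsGloballyMinimal], ¬ W.HasCM →
      IsOrdinaryAt W 2 → (∀ x : ℚ, ¬ HasRationalTwoTorsionX W x) → ¬ IsSquare W.Δ → W.analyticRank = 0 →
      ∀ (κ : ZpExtension ℚ 2) (γ : Field.absoluteGaloisGroup ℚ), κ.IsCyclotomic → κ.IsTopGenerator γ → IsCyclotomicVariable 2 γ → ∀ D : W.SelmerDualData κ γ,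
        ∃ n : ℕ, D.lambda < 2 ^ n ∧ (∀ m, 0 < Nat.card ↥(W.selmerLayer κ m) * Nat.card (W.KerG κ m)) ∧
          Nat.card ↥(W.selmerLayer κ (n + 1)) * Nat.card (W.KerG κ (n + 1)) < 2 ^ (2 ^ n) * (Nat.card ↥(W.selmerLayer κ n) * Nat.card (W.KerG κ n))) :
    MainConjectureOfRankZeroBSDAtTwo := by
  intro W _ _ hcm hord ht hsq hr _hμan hbsd
  exact mazurMainConjecture_two_of_bsdp_of_layerRatio_lt W (fun f => h17 W f) hper hmod hGZK hord ht hr hbsd (hcert W hcm hord ht hsq hr)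

end Crux

end Summit.BirchSwinnertonDyer.BirchSwinnertonDyer.Theorems.AlignedTransportAtTwoHalfDescentBaseIndexSeedExact

end
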